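import Summits.CriticalPhenomena.PercolationContinuityZ3.Theorems.Transplant.SkelPhiRunQSteps
import HarnessLib

/-!
# Quasi-step rung (N3-b), LEVEL 1, row α5 of WAVE-Q-MANIFEST under (ι) := `Skelφ.QStepsN G φ M` (design owner p3-g29 / refuter p5-g28 F2, 2026-08-27): THE RUN FRAMES
# HAVE QUASI-STEPS OF COST `M·(k + 3)` when the chart `φ` itself has only EXACT-FOOTPRINT QUASI-STEPS of cost `M` — `QStepsN G (runX φ c₀ n h σ) (M (k+3))` and the same
# for `runY` (`QStepsN G φ M`, `1 ≤ n`, `|h| ≤ k·n`, `σ = ±1`); the `×M` twin of «SkelPhiRunQSteps» §3 (`qStepsN_runX/runY`, p1 gen 11, which assumed `Steps G φ`)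

builds on p205010 (kernel theorem, internal audit signed; external expert review pending) — nothing in this file uses p205010; nothing here is a claim about any open node; no carrier,
no node, no definition.  Lane `prim-bschramm`, seat `prim-bschramm-gen-1` (gen 4; GEN pen).  Helper file (`--supports stmt-CriticalPhenomena-4575 --as helper`).
WHY (HOME/WAVE-Q-MANIFEST.md v0.3 §3 row α5; the one LEVEL-0 reader of `Steps` on the run frames in the used cone of p486426).  Under the exact footprint every inner vertex `u` of
a φ-link has `φ u = φ (node)`, hence the SAME run-frame value as the node (`runX` is a function of `φ`): p1 gen 11's construction (pre-correcting `e_β`-column of single steps,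
then one `e_α`-step; residues by `exists_precorrection` / `exists_first_exit_up/down`) goes through with the column `Skelφ.walk` replaced by the quasi-walk `Skelφ.walkQ`
(«SkelPhiQStepsN») and the links of the column CONCATENATED (`exists_walk_of_linkChain`: a walk of length `≤ M·m` through the nodes whose every vertex carries a NODE's
φ-value); the footprint statements `runX_walkQ_zero`, `sshear_walkQ`, the level bookkeeping and the two moves are then VERBATIM, with cost `k + 3 ↦ M·(k + 3)`.
* §1 `exists_walk_of_linkChain`, `runX_congr` (run frames are functions of `φ`), `runX_walkQ_zero`, `sshear_walkQ`;
* §2 **`runX_tangential_q`**, **`runX_inward_q`**, **`qStepsN_runX_of_qStepsN`**, **`qStepsN_runY_of_qStepsN`**.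
Regression: at `M = 1` (`qStepsN_of_steps`) the cost is `k + 3`, the statement of «SkelPhiRunQSteps».
[cite: MartineauTassion2017, §3 (the sheared coordinates (x, y′)), §4.3] [cite: KozmaNitzan2024, §4 p. 26 ((29): columns)]
-/

noncomputable section

open scoped Classical

namespace Summit.CriticalPhenomena.PercolationContinuityZ3.Theorems.Transplant

namespace Skelφ

open Literature.Probability.Percolation Literature.Probability.LatticeModels SimpleGraph
open Literature.Barriers.CriticalPhenomena (graphBall graphBall_mono mem_graphBall_self)

variable {V : Type} {G : SimpleGraph V} {φ : V → Site 2} {M : ℕ}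

/-! ## §1 Chains of links as walks; the quasi-column in the run frame -/

/-- **A chain of links `f 0 ⇝ f 1 ⇝ ⋯ ⇝ f m` is a walk of length `≤ N·m` every vertex of which carries the chart value of an EARLIER node `f i`, `i < m`,
or is the last node `f m`** (the exact footprint of `LinkN`, concatenated). [folklore] -/
theorem exists_walk_of_linkChain {F : V → Site 2} {N : ℕ} (f : ℕ → V) (hf : ∀ i, LinkN G F N (f i) (f (i + 1))) (m : ℕ) :
    ∃ p : G.Walk (f 0) (f m), p.length ≤ N * m ∧ ∀ u ∈ p.support, (∃ i, i < m ∧ F u = F (f i)) ∨ u = f m := by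
  induction m with
  | zero => exact ⟨Walk.nil, by simp, fun u hu => Or.inr (by rw [Walk.support_nil, List.mem_singleton] at hu; exact hu)⟩
  | succ m ih =>
    obtain ⟨p, hp, hs⟩ := ih
    obtain ⟨q, hq, hF⟩ := hf m
    refine ⟨p.append q, by rw [Walk.length_append, Nat.mul_succ]; omega, fun u hu => ?_⟩
    rw [Walk.mem_support_append_iff] at hu
    rcases hu with hu | hu
    · rcases hs u hu with ⟨i, hi, e⟩ | rfl
      · exact Or.inl ⟨i, by omega, e⟩
      · exact Or.inl ⟨m, by omega, rfl⟩
    · rcases hF u hu with e | e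
      · exact Or.inl ⟨m, by omega, e⟩
      · exact Or.inr e

/-- The run frame is a function of the chart value. [folklore] -/
theorem runX_congr (c₀ : V) (n : ℕ) (h σ : ℤ) {u v : V} (huv : φ u = φ v) : runX φ c₀ n h σ u = runX φ c₀ n h σ v := by
  funext j; fin_cases j
  · show runX φ c₀ n h σ u 0 = runX φ c₀ n h σ v 0
    rw [runX_zero, runX_zero, relCoord_apply, relCoord_apply, huv]
  · show runX φ c₀ n h σ u 1 = runX φ c₀ n h σ v 1
    rw [runX_one, runX_one, shearCoord_apply, shearCoord_apply, huv]

/-- Along an `e_β`-quasi-column the raw run coordinate is constant at the nodes (under `QStepsN`). [folklore] -/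
theorem runX_walkQ_zero (hq : QStepsN G φ M) (c₀ : V) (n : ℕ) (h σ : ℤ) (τ : ℤˣ) (w : V) (i : ℕ) :
    runX φ c₀ n h σ (walkQ G φ M 1 τ w i) 0 = runX φ c₀ n h σ w 0 := by
  rw [runX_zero, runX_zero, relCoord_apply, relCoord_apply, F_walkQ hq]; simp

/-- Along an `e_β`-quasi-column `σβ′` moves by `σ τ n` per node (under `QStepsN`). [folklore] -/
theorem sshear_walkQ (hq : QStepsN G φ M) (c₀ : V) (n : ℕ) (h σ : ℤ) (τ : ℤˣ) (w : V) (i : ℕ) :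
    σ * shearCoord φ c₀ n h (walkQ G φ M 1 τ w i) = σ * shearCoord φ c₀ n h w + σ * (τ : ℤ) * n * i := by
  rw [shearCoord_apply, shearCoord_apply, F_walkQ hq]; simp; ring

/-! ## §2 The quasi-steps of the run frames from quasi-steps of the chart -/

section Moves

variable (hq : QStepsN G φ M) {n : ℕ} (hn : 1 ≤ n) (c₀ : V) (h : ℤ) {σ : ℤ} (hσ : σ = 1 ∨ σ = -1) {k : ℕ} (hκ : h.natAbs ≤ k * n)
include hq hn hσ hκ

/-- **TANGENTIAL QUASI-STEP OF THE x-RUN FRAME (chart with quasi-steps of cost `M`)**: `σα` moves by `τ = ±1` at fixed level through a walk of length `≤ M(k + 2)` whose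
inner vertices are at the frame value of the start (pre-correcting `e_β`-quasi-column of `≤ k + 1` links, then one `e_α`-link). [this work] -/
theorem runX_tangential_q (w : V) (τ : ℤˣ) :
    ∃ w', runX φ c₀ n h σ w' = runX φ c₀ n h σ w + Pi.single 0 (τ : ℤ) ∧ LinkN G (runX φ c₀ n h σ) (M * (k + 3)) w w' := by
  have hn0 : (0 : ℤ) < n := by exact_mod_cast hn
  have hU := shearUnit_pos hn h
  have hσσ : σ * σ = 1 := by rcases hσ with rfl | rfl <;> simp
  obtain ⟨σu, hσu⟩ : ∃ u : ℤˣ, (u : ℤ) = σ := by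
    rcases hσ with rfl | rfl
    · exact ⟨1, rfl⟩
    · exact ⟨-1, rfl⟩
  set ψ := runX φ c₀ n h σ with hψ
  set U : ℤ := (shearUnit n h : ℤ) with hUdef
  have hUeq : U = n + h.natAbs := by rw [hUdef]; unfold shearUnit; push_cast; rfl
  -- the residue of `w`
  set s := σ * shearCoord φ c₀ n h w with hs
  set q := ψ w 1 with hqq
  set r := s - U * q with hr
  have hqdef : q = s / U := by rw [hqq, hψ, runX_one]
  have hr0 : 0 ≤ r := by rw [hr, hqdef]; have := Int.emod_nonneg s hU.ne'; rw [Int.emod_def] at this; linarith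
  have hrU : r < U := by rw [hr, hqdef]; have := Int.emod_lt_of_pos s hU; rw [Int.emod_def] at this; linarith
  -- the α-move shifts `σβ′` by `e = −h τ`
  set e : ℤ := -(h * (τ : ℤ)) with he
  have hτ1 : |(τ : ℤ)| = 1 := by rcases Int.units_eq_one_or τ with h1 | h1 <;> simp [h1]
  have heU : |e| + n ≤ U := by
    rw [he, abs_neg, abs_mul, hτ1, mul_one, hUeq, ← Int.natCast_natAbs]; linarith
  obtain ⟨j, hj0, hjU, hje0, hjeU, hjabs⟩ := exists_precorrection hn0 hr0 hrU heU
  -- the pre-correcting quasi-column: direction `d` with `σ d n |j| = n j`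
  obtain ⟨d, hd⟩ : ∃ d : ℤˣ, σ * (d : ℤ) * n * (j.natAbs : ℤ) = n * j := by
    rcases le_or_gt 0 j with hj | hj
    · refine ⟨σu, ?_⟩; rw [hσu, hσσ, one_mul, Int.natAbs_of_nonneg hj]
    · refine ⟨-σu, ?_⟩
      rw [Units.val_neg, hσu, mul_neg, hσσ, Int.ofNat_natAbs_of_nonpos hj.le]; ring
  set f : ℕ → V := fun i => walkQ G φ M 1 d w i with hf
  have hf0 : ∀ i, ψ (f i) 0 = ψ w 0 := fun i => runX_walkQ_zero hq c₀ n h σ d w i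
  have hfs : ∀ i, σ * shearCoord φ c₀ n h (f i) = s + σ * (d : ℤ) * n * i := fun i => sshear_walkQ hq c₀ n h σ d w i
  -- every node up to `|j|` keeps the level `q`
  have hlev : ∀ i : ℕ, i ≤ j.natAbs → ψ (f i) 1 = q := by
    intro i hi
    have hsi := hfs i
    have hbetween : (0 ≤ σ * (d : ℤ) * n * i ∧ σ * (d : ℤ) * n * i ≤ n * j) ∨ (n * j ≤ σ * (d : ℤ) * n * i ∧ σ * (d : ℤ) * n * i ≤ 0) := by
      have hi' : (i : ℤ) ≤ j.natAbs := by exact_mod_cast hi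
      have hdn : σ * (d : ℤ) * n = n ∨ σ * (d : ℤ) * n = -n := by
        rcases hσ with rfl | rfl <;> rcases Int.units_eq_one_or d with h1 | h1 <;> simp [h1]
      rcases hdn with h1 | h1
      · rw [h1] at hd ⊢
        left; constructor
        · positivity
        · calc (n : ℤ) * i ≤ n * j.natAbs := by gcongr
            _ = n * j := hd
      · rw [h1] at hd ⊢
        have hmul := mul_le_mul_of_nonneg_left hi' hn0.le
        have hpos : (0 : ℤ) ≤ n * i := by positivity
        right; constructor
        · calc (n : ℤ) * j = -↑n * ↑j.natAbs := hd.symm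
            _ ≤ -↑n * i := by linarith
        · linarith
    apply runX_one_eq_of_residue hn c₀ h σ (f i) (q := q) (r' := r + σ * (d : ℤ) * n * i)
    · rw [hsi, hr]; ring
    · rcases hbetween with ⟨h1, h2⟩ | ⟨h1, h2⟩ <;> linarith
    · rcases hbetween with ⟨h1, h2⟩ | ⟨h1, h2⟩ <;> [linarith; linarith]
  -- the α-link from the column's end
  obtain ⟨w', hφ', hlink⟩ := hq (f j.natAbs) 0 (τ * σu)
  have hφ'' : φ w' = φ (f j.natAbs) + Pi.single 0 ((τ : ℤ) * σ) := by rw [hφ']; simp [hσu]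
  have hstep0 := runX_of_step_zero (φ := φ) c₀ n h σ hφ''
  have hw'0 : ψ w' 0 = ψ w 0 + τ := by
    rw [hψ, hstep0.1, ← hψ, hf0]
    have : σ * ((τ : ℤ) * σ) = τ * (σ * σ) := by ring
    rw [this, hσσ, mul_one]
  have hw'1 : ψ w' 1 = q := by
    apply runX_one_eq_of_residue hn c₀ h σ w' (q := q) (r' := r + n * j + e)
    · rw [hstep0.2, hfs, hd, hr, he]
      have : σ * h * ((τ : ℤ) * σ) = h * τ * (σ * σ) := by ring
      rw [this, hσσ, mul_one]; ring
    · exact hje0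
    · exact hjeU
  refine ⟨w', ?_, ?_⟩
  · funext i; fin_cases i
    · show ψ w' 0 = (ψ w + Pi.single (0 : Fin 2) (τ : ℤ) : Site 2) 0
      rw [Pi.add_apply, Pi.single_eq_same, hw'0]
    · show ψ w' 1 = (ψ w + Pi.single (0 : Fin 2) (τ : ℤ) : Site 2) 1
      rw [Pi.add_apply, Pi.single_eq_of_ne (by decide), add_zero, hw'1]
  · obtain ⟨p, hp, hsupp⟩ := exists_walk_of_linkChain (G := G) f (fun i => walkQ_link hq 1 d w i) j.natAbs
    obtain ⟨p₂, hp₂, hF₂⟩ := hlink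
    have hf00 : f 0 = w := rfl
    refine ⟨(p.copy hf00 rfl).append p₂, ?_, fun u hu => ?_⟩
    · rw [Walk.length_append, Walk.length_copy]
      -- `|j| ≤ k + 1` from `|n j| < U ≤ (k+1) n`
      have h1 : (j.natAbs : ℤ) * n = |n * j| := by rw [abs_mul, Int.natCast_natAbs, abs_of_pos hn0, mul_comm]
      have h2 : (h.natAbs : ℤ) ≤ k * n := by exact_mod_cast hκ
      have hj' : (j.natAbs : ℤ) * n < ((k : ℤ) + 2) * n := by rw [h1]; linarith
      have hj'' : (j.natAbs : ℤ) < (k : ℤ) + 2 := lt_of_mul_lt_mul_right hj' hn0.le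
      have hjk : j.natAbs ≤ k + 1 := by omega
      have : M * j.natAbs + M ≤ M * (k + 3) := by nlinarith
      omega
    · rw [Walk.mem_support_append_iff, Walk.support_copy] at hu
      -- every vertex of the column part and every inner vertex of the last link carries the value of a column node (level `q`, raw coordinate of `w`)
      have hnode : ∀ i, i ≤ j.natAbs → ψ (f i) = ψ w := fun i hi => by
        funext c; fin_cases c
        · exact hf0 i
        · show ψ (f i) 1 = ψ w 1
          rw [hlev i hi]
      rcases hu with hu | hu
      · left
        rcases hsupp u hu with ⟨i, hi, hφu⟩ | rfl
        · rw [show ψ u = ψ (f i) from runX_congr c₀ n h σ hφu]; exact hnode i hi.le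
        · exact hnode _ le_rfl
      · rcases hF₂ u hu with hφu | rfl
        · left
          rw [show ψ u = ψ (f j.natAbs) from runX_congr c₀ n h σ hφu]; exact hnode _ le_rfl
        · right; rfl

/-- **INWARD QUASI-STEP OF THE x-RUN FRAME (chart with quasi-steps of cost `M`)**: the level moves by `τ = ±1` at fixed `σα` through an `e_β`-quasi-column of
`≤ k + 2` links whose first nodes keep the start level. [this work] -/
theorem runX_inward_q (w : V) (τ : ℤˣ) :
    ∃ w', runX φ c₀ n h σ w' = runX φ c₀ n h σ w + Pi.single 1 (τ : ℤ) ∧ LinkN G (runX φ c₀ n h σ) (M * (k + 3)) w w' := by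
  have hn0 : (0 : ℤ) < n := by exact_mod_cast hn
  have hU := shearUnit_pos hn h
  have hσσ : σ * σ = 1 := by rcases hσ with rfl | rfl <;> simp
  obtain ⟨σu, hσu⟩ : ∃ u : ℤˣ, (u : ℤ) = σ := by
    rcases hσ with rfl | rfl
    · exact ⟨1, rfl⟩
    · exact ⟨-1, rfl⟩
  set ψ := runX φ c₀ n h σ with hψ
  set U : ℤ := (shearUnit n h : ℤ) with hUdef
  have hUeq : U = n + h.natAbs := by rw [hUdef]; unfold shearUnit; push_cast; rfl
  have hnU : (n : ℤ) ≤ U := by rw [hUeq]; exact le_add_of_nonneg_right (by positivity)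
  have hUk : U ≤ (k + 1 : ℕ) * n := by
    have h2 : (h.natAbs : ℤ) ≤ k * n := by exact_mod_cast hκ
    rw [hUeq]; push_cast; linarith
  set s := σ * shearCoord φ c₀ n h w with hs
  set q := ψ w 1 with hqq
  set r := s - U * q with hr
  have hqdef : q = s / U := by rw [hqq, hψ, runX_one]
  have hr0 : 0 ≤ r := by rw [hr, hqdef]; have := Int.emod_nonneg s hU.ne'; rw [Int.emod_def] at this; linarith
  have hrU : r < U := by rw [hr, hqdef]; have := Int.emod_lt_of_pos s hU; rw [Int.emod_def] at this; linarith
  -- direction `d` with `σ d = τ`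
  set d : ℤˣ := τ * σu with hd
  have hσd : σ * (d : ℤ) * n = τ * n := by
    rw [hd, Units.val_mul, hσu]
    have : σ * ((τ : ℤ) * σ) * n = τ * n * (σ * σ) := by ring
    rw [this, hσσ, mul_one]
  set f : ℕ → V := fun i => walkQ G φ M 1 d w i with hf
  have hf0 : ∀ i, ψ (f i) 0 = ψ w 0 := fun i => runX_walkQ_zero hq c₀ n h σ d w i
  have hfs : ∀ i : ℕ, σ * shearCoord φ c₀ n h (f i) = s + τ * n * i := fun i => by rw [sshear_walkQ hq c₀ n h σ d w i, hσd]
  have key : ∃ m : ℕ, 1 ≤ m ∧ (n : ℤ) * m ≤ U + n ∧ (∀ i : ℕ, i < m → ψ (f i) 1 = q) ∧ ψ (f m) 1 = q + τ := by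
    rcases Int.units_eq_one_or τ with h1 | h1
    · obtain ⟨m, hm1, hmU, hbefore, hge, hlt⟩ := exists_first_exit_up hn0 hnU hr0 hrU
      refine ⟨m, hm1, hmU, fun i hi => ?_, ?_⟩
      · apply runX_one_eq_of_residue hn c₀ h σ (f i) (q := q) (r' := r + n * i)
        · rw [hfs, hr, h1]; push_cast; ring
        · positivity
        · exact hbefore i hi
      · apply runX_one_eq_of_residue hn c₀ h σ (f m) (q := q + τ) (r' := r + n * m - U)
        · rw [hfs, hr, h1]; push_cast; ring
        · linarith
        · linarith
    · obtain ⟨m, hm1, hmU, hbefore, hlt, hge⟩ := exists_first_exit_down hn0 hnU hr0 hrU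
      refine ⟨m, hm1, hmU, fun i hi => ?_, ?_⟩
      · apply runX_one_eq_of_residue hn c₀ h σ (f i) (q := q) (r' := r - n * i)
        · rw [hfs, hr, h1]; push_cast; ring
        · exact hbefore i hi
        · linarith [show (0 : ℤ) ≤ n * i by positivity]
      · apply runX_one_eq_of_residue hn c₀ h σ (f m) (q := q + τ) (r' := r - n * m + U)
        · rw [hfs, hr, h1]; push_cast; ring
        · linarith
        · linarith
  obtain ⟨m, hm1, hmU, hbefore, hlast⟩ := key
  refine ⟨f m, ?_, ?_⟩
  · funext i; fin_cases i
    · show ψ (f m) 0 = (ψ w + Pi.single (1 : Fin 2) (τ : ℤ) : Site 2) 0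
      rw [Pi.add_apply, Pi.single_eq_of_ne (by decide), add_zero, hf0]
    · show ψ (f m) 1 = (ψ w + Pi.single (1 : Fin 2) (τ : ℤ) : Site 2) 1
      rw [Pi.add_apply, Pi.single_eq_same, hlast]
  · obtain ⟨p, hp, hsupp⟩ := exists_walk_of_linkChain (G := G) f (fun i => walkQ_link hq 1 d w i) m
    have hf00 : f 0 = w := rfl
    refine ⟨p.copy hf00 rfl, ?_, fun u hu => ?_⟩
    · rw [Walk.length_copy]
      have hm' : (n : ℤ) * m ≤ n * ((k : ℤ) + 2) := by push_cast at hUk; linarith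
      have hm'' : (m : ℤ) ≤ (k : ℤ) + 2 := le_of_mul_le_mul_left hm' hn0
      have hmk : m ≤ k + 2 := by omega
      have : M * m ≤ M * (k + 3) := by nlinarith
      omega
    · rw [Walk.support_copy] at hu
      rcases hsupp u hu with ⟨i, hi, hφu⟩ | rfl
      · left
        rw [show ψ u = ψ (f i) from runX_congr c₀ n h σ hφu]
        funext c; fin_cases c
        · exact hf0 i
        · show ψ (f i) 1 = ψ w 1
          rw [hbefore i hi]
      · right; rfl

/-- **THE x-RUN FRAME HAS QUASI-STEPS OF COST `M(k + 3)`** when the chart has exact-footprint quasi-steps of cost `M` (`|h| ≤ k·n`, `1 ≤ n`, `σ = ±1`). [this work] -/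
theorem qStepsN_runX_of_qStepsN : QStepsN G (runX φ c₀ n h σ) (M * (k + 3)) := by
  intro w i τ
  fin_cases i
  · exact runX_tangential_q hq hn c₀ h hσ hκ w τ
  · exact runX_inward_q hq hn c₀ h hσ hκ w τ

/-- **THE y′-RUN FRAME HAS QUASI-STEPS OF COST `M(k + 3)`** (coordinates exchanged). [this work] -/
theorem qStepsN_runY_of_qStepsN : QStepsN G (runY φ c₀ n h σ) (M * (k + 3)) := by
  intro w i τ
  have hswap : ∀ u : V, runY φ c₀ n h σ u = fun j => runX φ c₀ n h σ u (if j = 0 then 1 else 0) := by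
    intro u; funext j; fin_cases j <;> simp [runY, runX]
  obtain ⟨w', hw', p, hp, htr⟩ := qStepsN_runX_of_qStepsN hq hn c₀ h hσ hκ w (if i = 0 then 1 else 0) τ
  refine ⟨w', ?_, p, hp, fun u hu => ?_⟩
  · rw [hswap, hswap, hw']
    funext j; fin_cases i <;> fin_cases j <;> simp
  · rcases htr u hu with h1 | h1
    · left; rw [hswap u, hswap w, h1]
    · right; exact h1

end Moves

end Skelφ

end Summit.CriticalPhenomena.PercolationContinuityZ3.Theorems.Transplant

end
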